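import Literature.AlgebraicGeometry.Frobenioids.PadicFrobenioidSplitting
import Literature.AlgebraicGeometry.Frobenioids.PadicFrobenioidModelType
import Literature.AlgebraicGeometry.Frobenioids.PadicFrobenioidQpSplit
import HarnessLib

/-!
# Frobenioids II, Theorem 1.2 (i) (second sentence) and (v): the schema rows over the free vocabulary
# record `V` — universal closures REFUTED, instance forms at THE bound slots PROVED (proof-only)

Mochizuki, *The geometry of Frobenioids II: poly-Frobenioids*, Kyushu J. Math. **62** (2008) 401–460,
§1, Theorem 1.2 (i), (v), kurims p. 9 [cite: MochizukiFrdII2008, Thm 1.2 (i) p.9]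
[cite: MochizukiFrdII2008, Thm 1.2 (v) p.9]: "(i) … For arbitrary `Λ`, the Frobenioid `C` is of isotropic,
model, Aut-ample, Aut^sub-ample, End-ample, and quasi-Frobenius-trivial type, but not of group-like type."
"(v) Suppose that `Φ` is absolutely primitive. Then `C` is of base-trivial type. Moreover, the element
`p ∈ ℚ_p^×` determines a characteristic splitting on `C`."

PROOF-ONLY companion of `PadicFrobenioidThm12.lean` (abc-iut cell, F fact-proving wave, seat abc-iut-f-047,
tranche 47; FACT-LIST rows **F-1188** `PadicFrd.Thm12_i_types` and **F-1192** `PadicFrd.Thm12_v`; same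
pattern as seat abc-iut-f-046's treatment of F-0725 / F-1187 in `PadicFrobenioidRmk122Closures.lean`). Both
declarations (seat abc-iut-L1-t4, SCHEMA NOTICE RQ7 N1 of the statement file) quantify over an ARBITRARY
record `V : Thm12Vocab d` of `Prop`-valued slots — "`C` is of model type" in (i), "`τ` is a characteristic
splitting" in (v) — and are therefore facts AT THE BOUND SLOTS ONLY (rule R5 of plan/FACT-LIST.md).
Kernel verdict:
* universal closures over `V` **REFUTED**: `Datum.not_forall_thm12_i_types` — for EVERY datum, no
  hypothesis (the record with all slots `False` violates the "model type" conjunct);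
  `Datum.not_forall_thm12_v_iff` — the closure of (v) fails EXACTLY when print's hypothesis "`Φ` absolutely
  primitive" holds (the all-`False` record admits no "characteristic splitting"), in particular at
  `C^⊢(ℚ_p)` (`not_forall_thm12_v_primQp`); fully closed forms `not_forall_datum_thm12_i_types`,
  `not_forall_datum_thm12_v` (witness `C^⊢(ℚ_2)`);
* instance forms **PROVED / cited**: (v) at THE binding of the splitting slot to [FrdI] Def. 2.3
  (`Thm12Vocab.bindSplitting`, seat abc-iut-L1-t4) holds for EVERY datum and EVERY record —
  `Datum.thm12_v_holds` = seat abc-iut-L1-t4's `Datum.thm12_v_bindSplitting` (p408303) BY NAME; (i) at every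
  record whose model-type slot is implied by THE [FrdI] Def. 4.5 (i) declaration
  `PreFrobenioid.IsOfModelType` (which presupposes that `C` IS a Frobenioid, as print does: "the Frobenioid
  `C` that arises as the model Frobenioid associated to this data [cf. [FrdI], Theorem 5.2, (ii)]", Ex. 1.1
  (ii) p. 8) — `Datum.thm12_i_types_of_isFrobenioid` (given `C` a Frobenioid; the six other clauses are
  unconditional, seats abc-iut-L1-d10 / abc-iut-w5: `thm12_i_types_of_isOfModelType`), premise-free over
  bases of FSM-type (`Datum.thm12_i_types_of_isOfFSMType`, e.g. `D = B^temp(Π, Π°)⁰` of Ex. 1.3 or `D = D₀`)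
  and hypothesis-free at `C^⊢(ℚ_p)` (`thm12_i_types_primQp`); the general bound form for data with
  `Φ`, `B` monoids on `D` is seat abc-iut-w5-d214's `Datum.thm12_i_types_of_slot`.
No definition, no new statement of print; nothing here bears on [IUTchIII] Cor. 3.12 ([FrdII] is a
refereed preparatory paper; a FACT row is an assumption label, not an endorsement); typed ≠ proved
elsewhere.
-/

namespace Literature.AlgebraicGeometry.Frobenioids

open CategoryTheory Opposite

universe v u

namespace PadicFrd

namespace Datum

variable {D : Type u} [Category.{v} D] {p : ℕ} [Fact p.Prime] (d : Datum D p)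

/-! ### F-1188 `Thm12_i_types`: universal closure over `V` refuted (every datum); instance forms -/

/-- **F-1188, universal closure over `V` REFUTED for every datum**: "Theorem 1.2 (i), second sentence,
for EVERY vocabulary record `V`" fails — the record with all slots `False` violates the free "model type"
conjunct (the other six conjuncts are theorems). No hypothesis on `d`.
[cite: MochizukiFrdII2008, Thm 1.2 (i) p.9] -/
theorem not_forall_thm12_i_types : ¬ ∀ V : Thm12Vocab d, Thm12_i_types d V :=
  fun h => (h ⟨False, False, fun _ => False, False, False, False⟩).2.1

/-- **F-1188, instance form** at every record whose model-type slot is implied by THE [FrdI] Def. 4.5 (i)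
declaration `PreFrobenioid.IsOfModelType` for `C = d.frobenioid` a Frobenioid (`hF`; square completion
`hsq`): Theorem 1.2 (i), second sentence, HOLDS — "model type" by `thm12_isOfModelType'` ([FrdI] Thm. 5.2
(ii) for model Frobenioids, `Φ` monoprime hence divisorial, `B` group-like), the six other clauses
(isotropic, `Aut`-, `Aut^sub`-, `End`-ample, quasi-Frobenius-trivial, not group-like) unconditionally
(`thm12_i_types_of_isOfModelType`). [cite: MochizukiFrdII2008, Thm 1.2 (i) p.9] -/
theorem thm12_i_types_of_isFrobenioid (hF : PreFrobenioid.IsFrobenioid d.structureFunctor)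
    (hsq : PreFrobenioid.HasBiratSquares d.structureFunctor) (V : Thm12Vocab d)
    (hV : PreFrobenioid.IsOfModelType d.structureFunctor hF hsq → V.IsOfModelType) :
    Thm12_i_types d V :=
  d.thm12_i_types_of_isOfModelType V (hV (d.thm12_isOfModelType' hF hsq))

/-- **F-1188, instance form, premise-free over a base of FSM-type** (e.g. `D = B^temp(Π, Π°)⁰` of Ex. 1.3
(i), or `D = D₀`), where `Φ`, `B` are automatically monoids on `D` and `C` is a Frobenioid
(`isFrobenioid_of_isOfFSMType`, with THE square completion `hasBiratSquares`): Theorem 1.2 (i), second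
sentence, holds at every record whose model-type slot is implied by `PreFrobenioid.IsOfModelType`.
[cite: MochizukiFrdII2008, Thm 1.2 (i) p.9] -/
theorem thm12_i_types_of_isOfFSMType (hD : IsOfFSMType D) (V : Thm12Vocab d)
    (hV : PreFrobenioid.IsOfModelType d.structureFunctor (d.isFrobenioid_of_isOfFSMType hD)
        (d.hasBiratSquares (d.isFrobenioid_of_isOfFSMType hD)) → V.IsOfModelType) :
    Thm12_i_types d V :=
  d.thm12_i_types_of_isFrobenioid _ _ V hV

/-! ### F-1192 `Thm12_v`: universal closure over `V` refuted ⟺ print's hypothesis; THE bound instance -/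

/-- **F-1192, universal closure over `V` REFUTED ⟺ print's hypothesis**: "Theorem 1.2 (v) for EVERY
vocabulary record `V`" fails iff `Φ` is absolutely primitive (the all-`False` record admits no
"characteristic splitting"; if `Φ` is not absolutely primitive every instance holds vacuously).
[cite: MochizukiFrdII2008, Thm 1.2 (v) p.9] -/
theorem not_forall_thm12_v_iff : (¬ ∀ V : Thm12Vocab d, Thm12_v d V) ↔ d.IsAbsolutelyPrimitive := by
  refine ⟨fun h => ?_, fun hap h => ?_⟩
  · by_contra hap
    refine h fun V => ?_
    intro hap'
    exact (hap hap').elim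
  · obtain ⟨-, τ, hτ, -⟩ := h ⟨False, False, fun _ => False, False, False, False⟩ hap
    exact hτ

/-- **F-1192, THE bound instance form, every datum and every record** — Theorem 1.2 (v) with the
characteristic-splitting slot BOUND to [FrdI] Def. 2.3 (`Thm12Vocab.bindSplitting`: "`τ` is a
characteristic splitting" iff `τ` is the family of submonoids of a
`PreFrobenioid.CharacteristicSplitting d.structureFunctor`): "Suppose that `Φ` is absolutely primitive.
Then `C` is of base-trivial type. Moreover, the element `p ∈ ℚ_p^×` determines a characteristic splitting
on `C`" — seat abc-iut-L1-t4's `Datum.thm12_v_bindSplitting` (p408303; base-trivial clause seat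
abc-iut-L1-d10, splitting `Datum.pSplitting`) BY NAME. This is the kernel witness of FACT-LIST row F-1192
at THE binding; the unbound universal closure is false (`not_forall_thm12_v_iff`).
[cite: MochizukiFrdII2008, Thm 1.2 (v) p.9] -/
theorem thm12_v_holds (V : Thm12Vocab d) :
    Literature.AlgebraicGeometry.Frobenioids.PadicFrd.Thm12_v d V.bindSplitting :=
  d.thm12_v_bindSplitting V

end Datum

/-! ### The same at `C^⊢(ℚ_p)` and in fully closed form -/

section Qp

variable (p : ℕ) [Fact p.Prime]

/-- **F-1188 REFUTED at `C^⊢(ℚ_p)`**: not every vocabulary record satisfies Theorem 1.2 (i), second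
sentence, for the absolutely primitive `p`-adic Frobenioid of `ℚ_p`. [cite: MochizukiFrdII2008, Thm 1.2 (i) p.9] -/
theorem not_forall_thm12_i_types_primQp :
    ¬ ∀ V : Thm12Vocab (Datum.primQp p), Thm12_i_types (Datum.primQp p) V :=
  (Datum.primQp p).not_forall_thm12_i_types

/-- **F-1188 at `C^⊢(ℚ_p)`, hypothesis-free instance form**: the one-object base `Spec ℚ_p` is of FSM-type
(`isOfFSMType_discretePUnit`), so Theorem 1.2 (i), second sentence, holds there at every record whose
model-type slot is implied by `PreFrobenioid.IsOfModelType`. [cite: MochizukiFrdII2008, Thm 1.2 (i) p.9] -/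
theorem thm12_i_types_primQp (V : Thm12Vocab (Datum.primQp p))
    (hV : PreFrobenioid.IsOfModelType (Datum.primQp p).structureFunctor
        ((Datum.primQp p).isFrobenioid_of_isOfFSMType (isOfFSMType_discretePUnit))
        ((Datum.primQp p).hasBiratSquares
          ((Datum.primQp p).isFrobenioid_of_isOfFSMType (isOfFSMType_discretePUnit))) →
      V.IsOfModelType) :
    Thm12_i_types (Datum.primQp p) V :=
  (Datum.primQp p).thm12_i_types_of_isOfFSMType (isOfFSMType_discretePUnit) V hV

/-- **F-1192 REFUTED at `C^⊢(ℚ_p)`** (`Φ = ord(ℤ_p^⊳)` IS absolutely primitive,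
`primQp_isAbsolutelyPrimitive`): not every vocabulary record satisfies Theorem 1.2 (v) there.
[cite: MochizukiFrdII2008, Thm 1.2 (v) p.9] -/
theorem not_forall_thm12_v_primQp :
    ¬ ∀ V : Thm12Vocab (Datum.primQp p), Thm12_v (Datum.primQp p) V :=
  (Datum.primQp p).not_forall_thm12_v_iff.mpr (primQp_isAbsolutelyPrimitive p)

/-- **F-1188, fully closed form REFUTED** (all binders universal; witness `C^⊢(ℚ_2)`).
[cite: MochizukiFrdII2008, Thm 1.2 (i) p.9] -/
theorem not_forall_datum_thm12_i_types :
    ¬ ∀ (D : Type) [Category.{0} D] (p : ℕ) [Fact p.Prime] (d : Datum D p) (V : Thm12Vocab d),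
        Thm12_i_types d V :=
  fun h => not_forall_thm12_i_types_primQp 2 (h _ 2 _)

/-- **F-1192, fully closed form REFUTED** (all binders universal; witness `C^⊢(ℚ_2)`).
[cite: MochizukiFrdII2008, Thm 1.2 (v) p.9] -/
theorem not_forall_datum_thm12_v :
    ¬ ∀ (D : Type) [Category.{0} D] (p : ℕ) [Fact p.Prime] (d : Datum D p) (V : Thm12Vocab d),
        Thm12_v d V :=
  fun h => not_forall_thm12_v_primQp 2 (h _ 2 _)

end Qp

end PadicFrd

end Literature.AlgebraicGeometry.Frobenioids
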